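import Summits.QuantumFields.YangMills.Theorems.BalabanUVNodesN15AtRRec13CoPH
import Summits.QuantumFields.YangMills.Theorems.BalabanUVNodesRateCarriersOfRecord13CoPHOn

/-!
# Route «BalabanUVNodes», cluster K4 «SpineRates» — node N15 = NE2 AT NODE 00's STAGE-13 v1.7 `CoPH` `Rg`-GUARDED TUPLE-KEYED RATE HOME `RRec₁₃CoPHOn 𝔯 Rg` BY NAME:
# the guarded θ-forms of the K4 stub `S_N15`, the read-out, the R422 honesty face, the transfers to ∕ from the canonical home `RRec₁₃CoPH 𝔯`, the guarded pin form,
# the guarded toys (LG-vector knit reading hypothesis-free; A2 trap)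

Cell `pub-ymgap`, seat `pub-ymgap-dag-n15-a` (-a KNIT-BY-NAME seat of node N15; HUMAN RULING D-0062; chair R424 venue), generation 14, part 74b (THEOREMS ONLY, 0 `def`,
0 `sorry`; companion of part 74 `…N15AtRRec13CoPH` under the 400-line cap).  `bears_on: R4∕N15 · K3⁷ SpineGivenEndpointR13SepCoPH (stmt-QuantumFields-20544, plan rev 24∕25;
dag-lead WORDS-143)`.  Filed `--kind proof --supports stmt-QuantumFields-20544 --as helper` — COUNT-NEUTRAL.

WHY.  The K3⁷ composer (dag-n27-c XXXIXᶜᵒᵖᴴ `…N27AtRecord13CoPHHomeOn`, XLI∕XLIIᶜᵒᵖᴴ, leaf B `…N27SpineGivenEndpointR13SepCoPHHomes`) reads N15's slot at dag-n22-e's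
`Rg`-GUARDED tuple-keyed home (5″ᶜᵒᵖᴴ `…RateCarriersOfRecord13CoPHOn`, p541389): `RRec₁₃CoPHOn 𝔯 Rg := fun F D g₀ os R => ∃ θ hP, Rg F θ ∧ θ.Admissible F N ∧
D = datumOfRecord₁₃CoPH F N θ hP ∧ ∃ k, R = rateCarriersOfRecord₁₃CoPH 𝔯 F θ hP g₀ os k` with `Rg := Node00.unityNondeg₁₃H 2`, as `h15 : S_N15 (RRec₁₃CoPHOn 𝔯 Rg)` —
displayed, N15 being the one rate slot without a producer face there (dag-n27-c `FIELD-TABLE-R13CoPH.md`).  This file gives the N15 side at that home, every proof ONE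
application of 5″'s master face `s_N15_rRec₁₃CoPHOn_iff` or of its transfers `k4_rRec₁₃CoPHOn_anti` ∕ `k4_rRec₁₃CoPH_of_rRec₁₃CoPHOn_true` ∕ `rRec₁₃CoPHOn_of_regime_params`
(dag-n16-e's `…N16AtRRec13CoPH` §2–§3 pattern for N16).

CONTENTS.  ★ **`s_N15_rRec₁₃CoPHOn_of_forall_regime`** (THE GUARDED θ-FORM `h15`: `N15At` at the reading's NE2 objects for every `θ : Stage13HParams F N` with provisos IN
`Rg` and admissible, along every `(g₀, os, k)` ⇒ `S_N15 (RRec₁₃CoPHOn 𝔯 Rg)`), `n15At_of_s_N15_rRec₁₃CoPHOn` ∕ `n15At_rateCarriersOfRecord₁₃CoPH_of_s_N15_rRec₁₃CoPHOn` (read-out),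
`s_N15_rRec₁₃CoPHOn_of_layers_forall_regime` (layers spelled out), `s_N15_rRec₁₃CoPHOn_of_guard_empty` (R422 honesty: no guarded admissible tuple ⇒ the stub holds
VACUOUSLY — content exactly on the guarded admissible tuples, whose existence at the guard of record is K0⁷ `Record13SepCoPHInhabited`, stmt-QuantumFields-20541, OPEN),
`s_N15_rRec₁₃CoPHOn_anti` (antitone in `Rg`), `s_N15_rRec₁₃CoPH_of_rRec₁₃CoPHOn_true`, `s_N15_rRec₁₃CoPH_of_rRec₁₃CoPHOn_of_regime_params`, `s_N15_homes₁₃CoPH_of_forall_admissible`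
(BOTH homes from the unguarded θ-form), ★ `s_N15_rRec₁₃CoPHOn_of_pin` (guarded pin-meets-estimate), `s_N15_rRec₁₃CoPHOn_of_knitReading` (the LG-vector knit reading closes the
guarded stub HYPOTHESIS-FREE — `N15Knit.N15_with_zero_layers_dim4`, MODEL level), `s_N15_rRec₁₃CoPHOn_of_emptyIndexReading` (A2 trap, excluded by RR-1's display).  The GENUINE
`U ≡ 1` family's readings at both homes and at the reading of record `readingOfRecord₁₃CoPH w1 ℓ₃ ne2 ne1` are part 75's (`…N15AtReadingOfRecord13CoPH`).

HONEST FRAMING.  Kernel bookkeeping BY NAME; no estimate is proved here; readings are PARAMETERS (the pin of `𝔯.lit · ne2` to Bałaban's run-indexed paired instances with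
backgrounds LIVE is Node 00's, residual); the hypothesis-free inhabitant is the `U ≡ 1` LG-vector torus MODEL; no guarded admissible Stage-13 tuple is claimed to exist (K0⁷
OPEN — where none exists the guarded stub is vacuous, `s_N15_rRec₁₃CoPHOn_of_guard_empty`); NE2⁺ NOT PRINTED beyond King's scalar template; **N15 is NOT discharged**;
count-neutral (typed 28∕28 · discharged 5∕27 of record unchanged); one finite four-torus at fixed ε — NOT ℝ⁴, NOT infinite volume, NOT OS, NOT a mass gap, NOT Clay.
Restate-immune (no Theses import).  No decl below carries a cite tag.
-/

set_option autoImplicit false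

noncomputable section
namespace Summit.QuantumFields.YangMills.BalabanUVNodes.N15.AtRRec13CoPH

open Literature.MathematicalPhysics.QuantumFieldTheory.Balaban1983to89
open Literature.MathematicalPhysics.QuantumFieldTheory.Balaban1983to89.T4Continuum (T4Family ULoop)
open Literature.MathematicalPhysics.QuantumFieldTheory.Balaban1983to89.T4EtaRate (PairedInstance NE2PlusOperator NE2PlusSite NE2PlusUnit)
open Literature.MathematicalPhysics.QuantumFieldTheory.Balaban1983to89.NE2NodeTorus (KnitIndex knitInstance knitOp166 knitSite163 covOpKernels inAll rhoDist)
open Node00 (IsDatumOfRecord₁₃CCoPH Stage13HParams NE2Objects₁₁)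
open Summit.QuantumFields.YangMills.Theorems.BalabanUVNodesN15Knit (N15_with_zero_layers_dim4)
open YMDAG.UVSplit (Datum NE2Carriers RateCarriers RateRecordPred N15At S_N15 ne2OfRecord₁₁ RateReading₁₃CoPH rateCarriersOfRecord₁₃CoPH RRec₁₃CoPH
  RRec₁₃CoPHOn rRec₁₃CoPHOn_self s_N15_rRec₁₃CoPHOn_iff k4_rRec₁₃CoPHOn_anti k4_rRec₁₃CoPH_of_rRec₁₃CoPHOn_true rRec₁₃CoPHOn_of_regime_params)

variable {N : ℕ} [NeZero N]

/-! ## §5 (of the N15 Stage-13 CoPH home chapter) The `Rg`-guarded tuple-keyed home `RRec₁₃CoPHOn 𝔯 Rg` (5″ᶜᵒᵖᴴ): the guarded θ-forms, honesty, transfers, pin, toys -/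

section Guarded

variable (𝔯 : RateReading₁₃CoPH N) (Rg : (F : T4Family) → Stage13HParams F N → Prop)

/-- ★ **THE GUARDED θ-FORM OF THE KNIT AT THE TUPLE-KEYED HOME** — what a prover of the pin discharges for the K3⁷ composer (`N = 2`, `Rg := Node00.unityNondeg₁₃H 2`):
`N15At` at the home's NE2 bundle of the reading for EVERY `θ : Stage13HParams F N` with provisos IN THE REGIME and admissible, along every `(g₀, os, k)` ⇒
`S_N15 (RRec₁₃CoPHOn 𝔯 Rg)` (layer B 5″'s master face `s_N15_rRec₁₃CoPHOn_iff`).  This is the `h15` n27-c's XXXIX∕XLI∕XLIIᶜᵒᵖᴴ and leaf B display. [bookkeeping] -/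
theorem s_N15_rRec₁₃CoPHOn_of_forall_regime
    (h : ∀ (F : T4Family) (θ : Stage13HParams F N) (hP : θ.Provisos₁₃CoPH F N), Rg F θ → θ.Admissible F N → ∀ (g₀ : ℕ → ℝ) (os : List (ULoop F)) (k : ℕ),
      N15At (ne2OfRecord₁₁ ((𝔯.lit F θ hP g₀ os).ne2 k))) :
    S_N15 (RRec₁₃CoPHOn 𝔯 Rg) :=
  (s_N15_rRec₁₃CoPHOn_iff 𝔯 Rg).2 h

/-- **THE READ-OUT**: under `S_N15 (RRec₁₃CoPHOn 𝔯 Rg)`, `N15At` at the reading's NE2 objects of every admissible tuple with provisos in the regime. [bookkeeping] -/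
theorem n15At_of_s_N15_rRec₁₃CoPHOn (hS : S_N15 (RRec₁₃CoPHOn 𝔯 Rg)) (F : T4Family) (θ : Stage13HParams F N) (hP : θ.Provisos₁₃CoPH F N) (hRg : Rg F θ)
    (hθ : θ.Admissible F N) (g₀ : ℕ → ℝ) (os : List (ULoop F)) (k : ℕ) : N15At (ne2OfRecord₁₁ ((𝔯.lit F θ hP g₀ os).ne2 k)) :=
  (s_N15_rRec₁₃CoPHOn_iff 𝔯 Rg).1 hS F θ hP hRg hθ g₀ os k

/-- … the same read at the BUNDLE OF RECORD `rateCarriersOfRecord₁₃CoPH 𝔯 F θ hP g₀ os k` (component `rfl`). [bookkeeping] -/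
theorem n15At_rateCarriersOfRecord₁₃CoPH_of_s_N15_rRec₁₃CoPHOn (hS : S_N15 (RRec₁₃CoPHOn 𝔯 Rg)) (F : T4Family) (θ : Stage13HParams F N) (hP : θ.Provisos₁₃CoPH F N)
    (hRg : Rg F θ) (hθ : θ.Admissible F N) (g₀ : ℕ → ℝ) (os : List (ULoop F)) (k : ℕ) : N15At (rateCarriersOfRecord₁₃CoPH 𝔯 F θ hP g₀ os k).ne2 :=
  n15At_of_s_N15_rRec₁₃CoPHOn 𝔯 Rg hS F θ hP hRg hθ g₀ os k

/-- **THE GUARDED θ-FORM, LAYERS SPELLED OUT**: the three NE2⁺ layers at the reading's NE2 objects for every admissible tuple with provisos in the regime ⇒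
`S_N15 (RRec₁₃CoPHOn 𝔯 Rg)`. [bookkeeping] -/
theorem s_N15_rRec₁₃CoPHOn_of_layers_forall_regime
    (h : ∀ (F : T4Family) (θ : Stage13HParams F N) (hP : θ.Provisos₁₃CoPH F N), Rg F θ → θ.Admissible F N → ∀ (g₀ : ℕ → ℝ) (os : List (ULoop F)) (k : ℕ),
      NE2PlusOperator ((𝔯.lit F θ hP g₀ os).ne2 k).c35 ((𝔯.lit F θ hP g₀ os).ne2 k).pi ((𝔯.lit F θ hP g₀ os).ne2 k).Kop ∧
      NE2PlusSite 4 ((𝔯.lit F θ hP g₀ os).ne2 k).p ((𝔯.lit F θ hP g₀ os).ne2 k).c35 ((𝔯.lit F θ hP g₀ os).ne2 k).pi ((𝔯.lit F θ hP g₀ os).ne2 k).Ksite ∧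
      NE2PlusUnit ((𝔯.lit F θ hP g₀ os).ne2 k).c35 ((𝔯.lit F θ hP g₀ os).ne2 k).pi ((𝔯.lit F θ hP g₀ os).ne2 k).Kunit ((𝔯.lit F θ hP g₀ os).ne2 k).inΛ
        ((𝔯.lit F θ hP g₀ os).ne2 k).unitDist) :
    S_N15 (RRec₁₃CoPHOn 𝔯 Rg) :=
  s_N15_rRec₁₃CoPHOn_of_forall_regime 𝔯 Rg fun F θ hP hRg hθ g₀ os k => (AtRateRecord11.n15At_ne2OfRecord₁₁_iff _).2 (h F θ hP hRg hθ g₀ os k)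

/-- **R422 HONESTY FACE — NO GUARDED ADMISSIBLE TUPLE ⇒ THE STUB HOLDS VACUOUSLY**: if no family carries a Stage-13 tuple with provisos that is in the regime AND admissible,
`S_N15 (RRec₁₃CoPHOn 𝔯 Rg)` holds with NO estimate — the guarded stub carries content exactly on the guarded admissible tuples, whose existence at the guard of record is K0⁷
(`Record13SepCoPHInhabited`, OPEN). [bookkeeping] -/
theorem s_N15_rRec₁₃CoPHOn_of_guard_empty (hno : ∀ (F : T4Family) (θ : Stage13HParams F N), θ.Provisos₁₃CoPH F N → Rg F θ → ¬ θ.Admissible F N) :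
    S_N15 (RRec₁₃CoPHOn 𝔯 Rg) :=
  s_N15_rRec₁₃CoPHOn_of_forall_regime 𝔯 Rg fun F θ hP hRg hθ _ _ _ => absurd hθ (hno F θ hP hRg)

/-- **ANTITONE IN THE REGIME** (5″'s `k4_rRec₁₃CoPHOn_anti`, N15's conjunct): proved over a larger regime, the stub holds over every smaller one. [bookkeeping] -/
theorem s_N15_rRec₁₃CoPHOn_anti {Rg Rg' : (F : T4Family) → Stage13HParams F N → Prop} (h : ∀ F θ, Rg F θ → Rg' F θ) (hS : S_N15 (RRec₁₃CoPHOn 𝔯 Rg')) :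
    S_N15 (RRec₁₃CoPHOn 𝔯 Rg) :=
  (k4_rRec₁₃CoPHOn_anti 𝔯 h).2.1 hS

/-- **FROM THE UNGUARDED TUPLE-KEYED HOME TO THE CANONICAL HOME** (5″'s `k4_rRec₁₃CoPH_of_rRec₁₃CoPHOn_true`, N15's conjunct). [bookkeeping] -/
theorem s_N15_rRec₁₃CoPH_of_rRec₁₃CoPHOn_true (hS : S_N15 (RRec₁₃CoPHOn 𝔯 fun _ _ => True)) : S_N15 (RRec₁₃CoPH 𝔯) :=
  (k4_rRec₁₃CoPH_of_rRec₁₃CoPHOn_true 𝔯).2.1 hS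

/-- **FROM A GUARDED HOME TO THE CANONICAL HOME WHEN EVERY CANONICAL PARAMETER IS IN THE REGIME** (5″'s `rRec₁₃CoPHOn_of_regime_params`): if every Stage-13 datum key's
canonical parameter lies in `Rg`, `S_N15 (RRec₁₃CoPHOn 𝔯 Rg)` gives `S_N15 (RRec₁₃CoPH 𝔯)`. [bookkeeping] -/
theorem s_N15_rRec₁₃CoPH_of_rRec₁₃CoPHOn_of_regime_params (hreg : ∀ (F : T4Family) (D : Datum F N) (h : IsDatumOfRecord₁₃CCoPH F N D), Rg F h.params)
    (hS : S_N15 (RRec₁₃CoPHOn 𝔯 Rg)) : S_N15 (RRec₁₃CoPH 𝔯) :=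
  fun F D g₀ os R hR => hS F D g₀ os R (rRec₁₃CoPHOn_of_regime_params 𝔯 Rg hreg hR)

/-- **BOTH HOMES FROM THE UNGUARDED θ-FORM AT ONCE**: `N15At` at the reading's NE2 objects for every admissible tuple with provisos (no regime) gives the stub at the
canonical home AND at every guarded tuple-keyed home. [bookkeeping] -/
theorem s_N15_homes₁₃CoPH_of_forall_admissible
    (h : ∀ (F : T4Family) (θ : Stage13HParams F N) (hP : θ.Provisos₁₃CoPH F N), θ.Admissible F N → ∀ (g₀ : ℕ → ℝ) (os : List (ULoop F)) (k : ℕ),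
      N15At (ne2OfRecord₁₁ ((𝔯.lit F θ hP g₀ os).ne2 k))) :
    S_N15 (RRec₁₃CoPH 𝔯) ∧ ∀ Rg' : (F : T4Family) → Stage13HParams F N → Prop, S_N15 (RRec₁₃CoPHOn 𝔯 Rg') :=
  ⟨s_N15_rRec₁₃CoPH_of_forall_admissible 𝔯 h, fun Rg' => s_N15_rRec₁₃CoPHOn_of_forall_regime 𝔯 Rg' fun F θ hP _ hθ g₀ os k => h F θ hP hθ g₀ os k⟩

/-- ★ **THE GUARDED PIN AS ONE POINTWISE EQUATION**: if the reading's `ne2` component agrees, on the admissible tuples with provisos IN THE REGIME, with a NAMED assignment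
`pin` carrying `N15At` there, then `S_N15 (RRec₁₃CoPHOn 𝔯 Rg)` — the shape in which a definer's N15 pin and an estimate seat's guarded ∀θ-theorem meet. [bookkeeping] -/
theorem s_N15_rRec₁₃CoPHOn_of_pin
    (pin : (F : T4Family) → (θ : Stage13HParams F N) → θ.Provisos₁₃CoPH F N → (ℕ → ℝ) → List (ULoop F) → ℕ → NE2Objects₁₁)
    (hpin : ∀ (F : T4Family) (θ : Stage13HParams F N) (hP : θ.Provisos₁₃CoPH F N), Rg F θ → θ.Admissible F N → ∀ (g₀ : ℕ → ℝ) (os : List (ULoop F)) (k : ℕ),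
      (𝔯.lit F θ hP g₀ os).ne2 k = pin F θ hP g₀ os k)
    (hest : ∀ (F : T4Family) (θ : Stage13HParams F N) (hP : θ.Provisos₁₃CoPH F N), Rg F θ → θ.Admissible F N → ∀ (g₀ : ℕ → ℝ) (os : List (ULoop F)) (k : ℕ),
      N15At (ne2OfRecord₁₁ (pin F θ hP g₀ os k))) :
    S_N15 (RRec₁₃CoPHOn 𝔯 Rg) :=
  s_N15_rRec₁₃CoPHOn_of_forall_regime 𝔯 Rg fun F θ hP hRg hθ g₀ os k => by
    rw [hpin F θ hP hRg hθ g₀ os k]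
    exact hest F θ hP hRg hθ g₀ os k

/-- **THE LG-VECTOR KNIT READING CLOSES THE GUARDED STUB, HYPOTHESIS-FREE** [decided toy, non-degenerate]: if on the admissible tuples with provisos in the regime the
reading's NE2 objects are the KNIT CARRIERS of this lineage's `U ≡ 1` Landau-gauge vector linear theory on the four-dimensional unit tori (`L ≥ 2`, `μ ≠ ν`), then
`S_N15 (RRec₁₃CoPHOn 𝔯 Rg)` by `N15Knit.N15_with_zero_layers_dim4`.  MODEL level. [bookkeeping] -/
theorem s_N15_rRec₁₃CoPHOn_of_knitReading (L : ℕ) [NeZero L] (hL : 2 ≤ L) {μ ν : Fin 4} (hμν : μ ≠ ν) (a b μ' lam α β : Fin 4) (c35 p : ℝ)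
    (h : ∀ (F : T4Family) (θ : Stage13HParams F N) (hP : θ.Provisos₁₃CoPH F N), Rg F θ → θ.Admissible F N → ∀ (g₀ : ℕ → ℝ) (os : List (ULoop F)) (k : ℕ),
      (𝔯.lit F θ hP g₀ os).ne2 k =
        { I := KnitIndex 3 L, c35 := c35, p := p, pi := knitInstance 3 L, Kop := knitOp166 L μ ν a b, Ksite := knitSite163 L μ' lam,
          Kunit := covOpKernels L α β, inΛ := inAll L, unitDist := rhoDist L }) :
    S_N15 (RRec₁₃CoPHOn 𝔯 Rg) :=
  s_N15_rRec₁₃CoPHOn_of_pin 𝔯 Rg (fun _ _ _ _ _ _ =>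
      { I := KnitIndex 3 L, c35 := c35, p := p, pi := knitInstance 3 L, Kop := knitOp166 L μ ν a b, Ksite := knitSite163 L μ' lam,
        Kunit := covOpKernels L α β, inΛ := inAll L, unitDist := rhoDist L }) h
    fun _ _ _ _ _ _ _ _ => (N15_with_zero_layers_dim4 L hL hμν a b μ' lam α β c35 p).1

/-- **A2 TRAP AT THE GUARDED HOME** [decided toy]: a reading whose NE2 objects have an EMPTY index on the admissible tuples with provisos in the regime has
`S_N15 (RRec₁₃CoPHOn 𝔯 Rg)` with NO estimate (n27-a's `n15At_of_isEmpty`); RR-1's populatedness display excludes exactly this corner. [bookkeeping] -/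
theorem s_N15_rRec₁₃CoPHOn_of_emptyIndexReading
    (h : ∀ (F : T4Family) (θ : Stage13HParams F N) (hP : θ.Provisos₁₃CoPH F N), Rg F θ → θ.Admissible F N → ∀ (g₀ : ℕ → ℝ) (os : List (ULoop F)) (k : ℕ),
      IsEmpty ((𝔯.lit F θ hP g₀ os).ne2 k).I) :
    S_N15 (RRec₁₃CoPHOn 𝔯 Rg) :=
  s_N15_rRec₁₃CoPHOn_of_forall_regime 𝔯 Rg fun F θ hP hRg hθ g₀ os k =>
    @Summit.QuantumFields.YangMills.Theorems.N15AtSpineCarriers.n15At_of_isEmpty (ne2OfRecord₁₁ ((𝔯.lit F θ hP g₀ os).ne2 k)) (h F θ hP hRg hθ g₀ os k)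

end Guarded

end Summit.QuantumFields.YangMills.BalabanUVNodes.N15.AtRRec13CoPH

end
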